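import Summits.HubbardSuperconductivity.HubbardLadder.Bounds.ComplexFugacityActivityBound
import Summits.HubbardSuperconductivity.HubbardLadder.Bounds.ComplexSeamGauge
import HarnessLib

/-!
# Twist insensitivity of the `t–t'` Hubbard polymer gas at COMPLEX fugacity

HONEST FRAMING (cell pub-hubbard): ladder R1–R4 with certified numbers; no claim on H/H₀. Bounds for
model classes (the seam-twisted translation-invariant `t–t'` Hubbard torus at a complex chemical
potential), no materials claim. Imports only landed modules and part F2 of this device
(`ComplexFugacityActivityBound`, LEAN FILING REQUEST #211.1; `ComplexSeamGauge` = #206.1).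

This is part F3 of the kernel device for bounds.tex Theorem 13 (canonical no-stiffness) in the
N-sector form: the grand-canonical twist-insensitivity mechanism of Theorem 12 (i) — column gauge,
winding dichotomy, Kotecký–Preiss tail estimate — run at a COMPLEX chemical potential `μ ∈ ℂ`
(complex fugacity), which is where the sector projection of part F1 (`SectorFourierProjection`)
evaluates the generalised Gibbs factor `Zc`.

THEOREMS (0 sorry; `L ≥ 3`, real `β, t', U, θ`, complex `μ`).
* `Zc_restrict_ttFluxCoupling_eq_complexMu`, `siteActivityC_ttFluxCoupling_twist_blind_complexMu`,
  `siteActivityC_twist_dichotomy_complexMu`, `ttActivityMu_eq_of_card_lt` — the column-gauge /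
  winding dichotomy at complex `U, μ`: a polymer with fewer than `L` sites has the same activity at
  twist `θ` and at twist `0` (the landed complex seam gauge `Zc_seamPhaseC_mul_eq` is already stated
  for complex on-site data; only the real-`μ` wrappers of #181.4 are re-instantiated).
* `sum_norm_ttActivityMu_mul_exp_le`, `isSmallActivityA_ttActivityMu` — one-site Kotecký–Preiss
  smallness `IsSmallActivityA (ρ_θ^μ) a δ` under `16 s e^{2s} (r e^{a+δ} + a)² ≤ a`,
  `s = |β|(1+|t'|)`, `r = siteRatio β U μ` (`= 1` for real `μ`; part F2's activity bound).
* `norm_polymerLogZ_ttActivityMu_sub_le` — the tail estimate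
  `‖log Ξ(ρ_θ^μ) - log Ξ(ρ_0^μ)‖ ≤ 2a L² e^{-δL}`.
* `Zc_ttFluxCoupling_eq_mul_polymerPartitionFunction_complexMu` — the polymer representation
  `Zc(β,U,μ; c_θ) = z₀(β,U,μ)^{L²} Ξ(ρ_θ^μ)` (`z₀ ≠ 0`).
* **`norm_Zc_twist_sub_le_complexMu`** — the complex-fugacity twist insensitivity of the generalised
  Gibbs factor: `‖Zc(c_θ) - Zc(c_0)‖ ≤ ‖Zc(c_0)‖ · (exp(2a L² e^{-δL}) - 1)` at every complex `μ` with
  `z₀(β,U,μ) ≠ 0` satisfying the smallness condition (bounds.tex §13, Lemma 13.1 and (13.2), arc part).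

References: bounds.tex §12 (Thm 12 (i)), §13 (Lemma 13.1, (13.2)); D. Ueltschi, J. Stat. Phys. 95
(1999) 693, §2.3 [Ueltschi1999]; R. Kotecký, D. Preiss, Comm. Math. Phys. 103 (1986) 491, Theorem
p. 492 [KoteckyPreiss1986].
-/

noncomputable section

namespace Summit.HubbardSuperconductivity.HubbardLadder.Bounds

open Matrix Finset Literature.MathematicalPhysics.QuantumLattice Literature.Probability.LatticeModels
open scoped ComplexConjugate

section Torus

open Literature.MathematicalPhysics.QuantumFieldTheory

variable {L : ℕ} [NeZero L]

/-- The polymer activities of the seam-twisted `t–t'` torus at a COMPLEX chemical potential `μ`: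
`ρ_θ^μ = siteActivityC (hubbardBonds (ttGraph L)) β U μ (ttFluxCoupling L β t' θ)` (for real `μ`
this is #181.5's `ttActivity`, `ttActivityMu_ofReal`). [programme definition: bounds.tex §13,
Lemma 13.1] -/
def ttActivityMu (L : ℕ) [NeZero L] (β t' U : ℝ) (μ : ℂ) (θ : ℝ) :
    Finset (FermionTorus 2 L) → ℂ :=
  siteActivityC (hubbardBonds (ttGraph L)) (β : ℂ) (U : ℂ) μ (ttFluxCoupling L β t' θ)

/-- At a real chemical potential the complex-fugacity activities are the activities of #181.5.
[this file] -/
theorem ttActivityMu_ofReal (β t' U μ θ : ℝ) :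
    ttActivityMu L β t' U (μ : ℂ) θ = ttActivity L β t' U μ θ := by
  unfold ttActivityMu ttActivity
  rfl

/-! ### The winding dichotomy at complex on-site data -/

/-- **Twist-blindness of restricted couplings at complex `U, μ`**: for a bond predicate avoiding the
column `k`, `Zc(β,U,μ; c_θ|_keep) = Zc(β,U,μ; c_0|_keep)` (the landed complex column gauge
`Zc_seamPhaseC_mul_eq`, which is stated for complex on-site data). [this file; bounds.tex §12
Lemma 12.5] -/
theorem Zc_restrict_ttFluxCoupling_eq_complexMu (hL : 3 ≤ L) (β t' θ : ℝ) (U μ : ℂ) {k : ℕ}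
    (hk : k < L) (keep : Bond (FermionTorus 2 L) → Prop) [DecidablePred keep]
    (hkeep : ∀ b, keep b → col b.1 ≠ k ∧ col b.2.1 ≠ k) :
    Zc (β : ℂ) U μ (fun b => if keep b then ttFluxCoupling L β t' θ b else 0) =
      Zc (β : ℂ) U μ (fun b => if keep b then ttFluxCoupling L β t' 0 b else 0) := by
  have hfac : (fun b => if keep b then ttFluxCoupling L β t' θ b else 0) =
      fun b => seamPhaseC L (θ : ℂ) b.1 b.2.1 * (if keep b then ttFluxCoupling L β t' 0 b else 0) := by
    funext b
    split_ifs
    · rw [← ttFluxCouplingC_ofReal hL β t' θ]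
      rfl
    · rw [mul_zero]
  rw [hfac]
  refine Zc_seamPhaseC_mul_eq hL (θ : ℂ) hk _ _ _ _ fun b hb => ?_
  by_cases hkb : keep b
  · simp only [if_pos hkb] at hb
    exact ⟨(hkeep b hkb).1, (hkeep b hkb).2, ttFluxCoupling_col_adjacent hL β t' 0 b hb⟩
  · simp only [if_neg hkb, ne_eq, not_true_eq_false] at hb

/-- **Twist-blindness of the site activities at complex `U, μ`**: for every bond universe `P` and
every site set `A` missing the column `k`, `ρ_θ(A) = ρ_0(A)`. [this file] -/
theorem siteActivityC_ttFluxCoupling_twist_blind_complexMu (hL : 3 ≤ L) (β t' θ : ℝ) (U μ : ℂ)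
    {k : ℕ} (hk : k < L) (P : Finset (Bond (FermionTorus 2 L))) {A : Finset (FermionTorus 2 L)}
    (hA : ∀ x ∈ A, col x ≠ k) :
    siteActivityC P (β : ℂ) U μ (ttFluxCoupling L β t' θ) A =
      siteActivityC P (β : ℂ) U μ (ttFluxCoupling L β t' 0) A :=
  siteActivityC_congr_of_Zc P _ _ _ fun K hK =>
    @Zc_restrict_ttFluxCoupling_eq_complexMu L _ hL β t' θ U μ k hk (fun b => b ∈ K) (_)
      (fun b hb => ⟨hA _ (hK b hb).1, hA _ (hK b hb).2⟩)

/-- **The twist dichotomy for polymers at complex `U, μ`**: every polymer either has the same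
activity at twist `θ` and at `0`, or has at least `L` sites (it meets every column). [this file] -/
theorem siteActivityC_twist_dichotomy_complexMu (hL : 3 ≤ L) (β t' θ : ℝ) (U μ : ℂ)
    (P : Finset (Bond (FermionTorus 2 L))) (A : Finset (FermionTorus 2 L)) :
    siteActivityC P (β : ℂ) U μ (ttFluxCoupling L β t' θ) A =
        siteActivityC P (β : ℂ) U μ (ttFluxCoupling L β t' 0) A ∨ L ≤ A.card := by
  by_cases h : ∀ k < L, ∃ x ∈ A, col x = k
  · exact Or.inr (le_card_of_meets_every_column h)
  · simp only [not_forall, not_exists, not_and, exists_prop] at h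
    obtain ⟨k, hk, hA⟩ := h
    exact Or.inl (siteActivityC_ttFluxCoupling_twist_blind_complexMu hL β t' θ U μ hk P hA)

/-- **Winding dichotomy** for the complex-fugacity activities: polymers with fewer than `L` sites have
the same activity at twist `θ` and at twist `0`. [this file] -/
theorem ttActivityMu_eq_of_card_lt (hL : 3 ≤ L) (β t' U : ℝ) (μ : ℂ) (θ : ℝ)
    {A : Finset (FermionTorus 2 L)} (hA : A.card < L) :
    ttActivityMu L β t' U μ θ A = ttActivityMu L β t' U μ 0 A := by
  rcases siteActivityC_twist_dichotomy_complexMu hL β t' θ (U : ℂ) μ (hubbardBonds (ttGraph L)) A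
    with h | h
  · exact h
  · exact absurd hA (not_lt.2 h)

/-! ### Kotecký–Preiss smallness at complex fugacity -/

/-- **One-site Kotecký–Preiss smallness of the complex-fugacity activities**: with
`s = |β|(1+|t'|)`, `r = siteRatio β U μ`, if `z₀(β,U,μ) ≠ 0`, `a, δ ≥ 0` and
`16 s e^{2s} (r e^{a+δ} + a)² ≤ a`, then `Σ_{A ∋ x} |ρ_θ^μ(A)| e^{(a+δ)|A|} ≤ a` for every site `x`
and every twist `θ`. [this file; part F2 `sum_norm_couplingActivity_mul_exp_le_catalan_exp_siteRatio`] -/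
theorem sum_norm_ttActivityMu_mul_exp_le (hL : 3 ≤ L) (β t' U : ℝ) {μ : ℂ} (θ : ℝ)
    (hz : atomicPartitionFn (β : ℂ) (U : ℂ) μ ≠ 0) {a δ : ℝ} (ha : 0 ≤ a) (hδ : 0 ≤ δ)
    (hsmall : 16 * (|β| * (1 + |t'|)) * Real.exp (2 * (|β| * (1 + |t'|))) *
      (siteRatio (β : ℂ) (U : ℂ) μ * Real.exp (a + δ) + a) ^ 2 ≤ a)
    (x : FermionTorus 2 L) (𝒜 : Finset (Finset (FermionTorus 2 L))) (h𝒜 : ∀ A ∈ 𝒜, x ∈ A) :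
    ∑ A ∈ 𝒜, ‖ttActivityMu L β t' U μ θ A‖ * Real.exp ((a + δ) * A.card) ≤ a := by
  have haδ : (0 : ℝ) ≤ a + δ := add_nonneg ha hδ
  have hF : siteRatio (β : ℂ) (U : ℂ) μ * Real.exp (a + δ) +
      16 * (|β| * (1 + |t'|)) * Real.exp (2 * (|β| * (1 + |t'|))) *
        (siteRatio (β : ℂ) (U : ℂ) μ * Real.exp (a + δ) + a) ^ 2 ≤
      siteRatio (β : ℂ) (U : ℂ) μ * Real.exp (a + δ) + a := by linarith
  have key : ∑ A ∈ 𝒜, ‖ttActivityMu L β t' U μ θ A‖ * Real.exp ((a + δ) * A.card) ≤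
      (siteRatio (β : ℂ) (U : ℂ) μ * Real.exp (a + δ) + a) -
        siteRatio (β : ℂ) (U : ℂ) μ * Real.exp (a + δ) := by
    simp only [ttActivityMu, siteActivityC_eq_couplingActivity]
    refine sum_norm_couplingActivity_mul_exp_le_catalan_exp_siteRatio hz
      (δ := fun b => ‖ttFluxCoupling L β t' θ b‖) (fun _ _ => le_rfl) haδ (fun v => ?_) hF x 𝒜 h𝒜
    -- the weighted degree `Σ_{b ∋ v} (e^{|c_b|} - 1) ≤ Σ_{b ∋ v} |c_b| e^{2s} ≤ 16 s e^{2s}`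
    have hem : ∀ x : ℝ, Real.exp x - 1 ≤ x * Real.exp x := fun x => by
      have h2 : Real.exp x * (-x + 1) ≤ Real.exp x * Real.exp (-x) :=
        mul_le_mul_of_nonneg_left (Real.add_one_le_exp (-x)) (Real.exp_pos x).le
      rw [← Real.exp_add, add_neg_cancel, Real.exp_zero] at h2
      linarith
    have hb1 : ∀ b : Bond (FermionTorus 2 L), Real.exp ‖ttFluxCoupling L β t' θ b‖ - 1 ≤
        ‖ttFluxCoupling L β t' θ b‖ * Real.exp (2 * (|β| * (1 + |t'|))) := fun b =>
      (hem _).trans (mul_le_mul_of_nonneg_left (Real.exp_le_exp.2 (by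
        have := norm_ttFluxCoupling_le hL β t' θ b; linarith)) (norm_nonneg _))
    refine (Finset.sum_le_sum fun b _ => hb1 b).trans ?_
    rw [← Finset.sum_mul]
    exact mul_le_mul_of_nonneg_right (sum_norm_ttFluxCoupling_le β t' θ v _
      fun b hb => (@mem_verts_iff _ (_) _ _).1 ((@Finset.mem_filter _ _ (_) _ _).1 hb).2)
      (Real.exp_nonneg _)
  linarith

/-- **Smallness with weight `a`**: under `16 s e^{2s} (r e^{a+δ} + a)² ≤ a`, `a, δ > 0`,
`z₀(β,U,μ) ≠ 0`, the complex-fugacity activities satisfy the tree's `IsSmallActivityA · a δ` for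
every twist `θ`. [this file] -/
theorem isSmallActivityA_ttActivityMu (hL : 3 ≤ L) (β t' U : ℝ) {μ : ℂ} (θ : ℝ)
    (hz : atomicPartitionFn (β : ℂ) (U : ℂ) μ ≠ 0) {a δ : ℝ} (ha : 0 < a) (hδ : 0 < δ)
    (hsmall : 16 * (|β| * (1 + |t'|)) * Real.exp (2 * (|β| * (1 + |t'|))) *
      (siteRatio (β : ℂ) (U : ℂ) μ * Real.exp (a + δ) + a) ^ 2 ≤ a) :
    IsSmallActivityA (ttActivityMu L β t' U μ θ) a δ where
  rho_empty := siteActivityC_empty _ _ _ _ _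
  a_pos := ha
  delta_pos := hδ
  sum_le x 𝒜 h𝒜 := sum_norm_ttActivityMu_mul_exp_le hL β t' U θ hz ha.le hδ.le hsmall x 𝒜 h𝒜

/-- **The tail estimate for the Kotecký–Preiss logarithms at complex fugacity**:
`‖log Ξ(ρ_θ^μ) - log Ξ(ρ_0^μ)‖ ≤ 2a L² e^{-δL}`. [this file; #196
`norm_polymerLogZ_sub_le_of_eq_of_card_lt` + the winding dichotomy] -/
theorem norm_polymerLogZ_ttActivityMu_sub_le (hL : 3 ≤ L) (β t' U : ℝ) {μ : ℂ} (θ : ℝ)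
    (hz : atomicPartitionFn (β : ℂ) (U : ℂ) μ ≠ 0) {a δ : ℝ} (ha : 0 < a) (hδ : 0 < δ)
    (hsmall : 16 * (|β| * (1 + |t'|)) * Real.exp (2 * (|β| * (1 + |t'|))) *
      (siteRatio (β : ℂ) (U : ℂ) μ * Real.exp (a + δ) + a) ^ 2 ≤ a) :
    ‖polymerLogZ polyInc (ttActivityMu L β t' U μ θ)
          (Finset.univ : Finset (FermionTorus 2 L)).powerset -
        polymerLogZ polyInc (ttActivityMu L β t' U μ 0)
          (Finset.univ : Finset (FermionTorus 2 L)).powerset‖ ≤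
      2 * a * (L : ℝ) ^ 2 * Real.exp (-(δ * L)) := by
  have hL0 : (0 : ℝ) < L := by exact_mod_cast (show 0 < L by omega)
  have hθ := isSmallActivityA_ttActivityMu hL β t' U θ hz ha hδ hsmall
  have h0 := isSmallActivityA_ttActivityMu hL β t' U 0 hz ha hδ hsmall
  have h := hθ.norm_polymerLogZ_sub_le_of_eq_of_card_lt h0
    (Finset.univ : Finset (FermionTorus 2 L)).powerset hL0
    (fun A _ hA => ttActivityMu_eq_of_card_lt hL β t' U μ θ (by exact_mod_cast hA))
  have hcard : (Fintype.card (FermionTorus 2 L) : ℝ) = (L : ℝ) ^ 2 := by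
    simp [FermionTorus, Fintype.card_lex]
  rw [hcard] at h
  exact h

/-! ### The polymer representation and the twist insensitivity of `Zc` at complex fugacity -/

/-- **Polymer representation at complex fugacity**: `Zc(β,U,μ; c_θ) = z₀(β,U,μ)^{|Λ_L|} Ξ(ρ_θ^μ)`
whenever `z₀(β,U,μ) ≠ 0` (#181.4a `Zc_eq_polymerGasZ` on the bond universe `hubbardBonds (ttGraph L)`).
[this file] -/
theorem Zc_ttFluxCoupling_eq_mul_polymerPartitionFunction_complexMu (hL : 3 ≤ L) (β t' U : ℝ)
    {μ : ℂ} (θ : ℝ) (hz : atomicPartitionFn (β : ℂ) (U : ℂ) μ ≠ 0) :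
    Zc (β : ℂ) (U : ℂ) μ (ttFluxCoupling L β t' θ) =
      atomicPartitionFn (β : ℂ) (U : ℂ) μ ^ Fintype.card (FermionTorus 2 L) *
        polymerPartitionFunction polyInc (ttActivityMu L β t' U μ θ)
          (Finset.univ : Finset (FermionTorus 2 L)).powerset := by
  rw [Zc_eq_polymerGasZ hz _ _ (fun b hb => mem_hubbardBonds_ttGraph_of_ne_zero hL hb)]
  unfold polymerGasZ ttActivityMu
  congr!

/-- **THEOREM (twist insensitivity of the generalised Gibbs factor at complex fugacity).** For
`L ≥ 3`, real `β, t', U, θ`, complex `μ` with `z₀(β,U,μ) ≠ 0`, `a, δ > 0` and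
`16 s e^{2s} (r e^{a+δ} + a)² ≤ a` (`s = |β|(1+|t'|)`, `r = siteRatio β U μ`):
`‖Zc(c_θ) - Zc(c_0)‖ ≤ ‖Zc(c_0)‖ · (exp(2a L² e^{-δL}) - 1)`. [this file; bounds.tex §13 (13.2),
arc part] -/
theorem norm_Zc_twist_sub_le_complexMu (hL : 3 ≤ L) (β t' U : ℝ) {μ : ℂ} (θ : ℝ)
    (hz : atomicPartitionFn (β : ℂ) (U : ℂ) μ ≠ 0) {a δ : ℝ} (ha : 0 < a) (hδ : 0 < δ)
    (hsmall : 16 * (|β| * (1 + |t'|)) * Real.exp (2 * (|β| * (1 + |t'|))) *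
      (siteRatio (β : ℂ) (U : ℂ) μ * Real.exp (a + δ) + a) ^ 2 ≤ a) :
    ‖Zc (β : ℂ) (U : ℂ) μ (ttFluxCoupling L β t' θ) - Zc (β : ℂ) (U : ℂ) μ (ttFluxCoupling L β t' 0)‖ ≤
      ‖Zc (β : ℂ) (U : ℂ) μ (ttFluxCoupling L β t' 0)‖ *
        (Real.exp (2 * a * (L : ℝ) ^ 2 * Real.exp (-(δ * L))) - 1) := by
  have hθ := isSmallActivityA_ttActivityMu hL β t' U θ hz ha hδ hsmall
  have h0 := isSmallActivityA_ttActivityMu hL β t' U 0 hz ha hδ hsmall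
  have htail := norm_polymerLogZ_ttActivityMu_sub_le hL β t' U θ hz ha hδ hsmall
  set ℓθ := polymerLogZ polyInc (ttActivityMu L β t' U μ θ)
    (Finset.univ : Finset (FermionTorus 2 L)).powerset with hℓθ
  set ℓ0 := polymerLogZ polyInc (ttActivityMu L β t' U μ 0)
    (Finset.univ : Finset (FermionTorus 2 L)).powerset with hℓ0
  set zp := atomicPartitionFn (β : ℂ) (U : ℂ) μ ^ Fintype.card (FermionTorus 2 L) with hzp
  have eθ : Zc (β : ℂ) (U : ℂ) μ (ttFluxCoupling L β t' θ) = zp * Complex.exp ℓθ := by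
    rw [Zc_ttFluxCoupling_eq_mul_polymerPartitionFunction_complexMu hL β t' U θ hz, hθ.exp_polymerLogZ]
  have e0 : Zc (β : ℂ) (U : ℂ) μ (ttFluxCoupling L β t' 0) = zp * Complex.exp ℓ0 := by
    rw [Zc_ttFluxCoupling_eq_mul_polymerPartitionFunction_complexMu hL β t' U 0 hz, h0.exp_polymerLogZ]
  have hdiff : Zc (β : ℂ) (U : ℂ) μ (ttFluxCoupling L β t' θ) - Zc (β : ℂ) (U : ℂ) μ (ttFluxCoupling L β t' 0) =
      Zc (β : ℂ) (U : ℂ) μ (ttFluxCoupling L β t' 0) * (Complex.exp (ℓθ - ℓ0) - 1) := by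
    rw [eθ, e0, Complex.exp_sub]
    field_simp [Complex.exp_ne_zero ℓ0]
  calc ‖Zc (β : ℂ) (U : ℂ) μ (ttFluxCoupling L β t' θ) - Zc (β : ℂ) (U : ℂ) μ (ttFluxCoupling L β t' 0)‖
      = ‖Zc (β : ℂ) (U : ℂ) μ (ttFluxCoupling L β t' 0)‖ * ‖Complex.exp (ℓθ - ℓ0) - 1‖ := by
        rw [hdiff, norm_mul]
    _ ≤ ‖Zc (β : ℂ) (U : ℂ) μ (ttFluxCoupling L β t' 0)‖ * (Real.exp ‖ℓθ - ℓ0‖ - 1) :=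
        mul_le_mul_of_nonneg_left (norm_cexp_sub_one_le_exp_norm_sub_one _) (norm_nonneg _)
    _ ≤ ‖Zc (β : ℂ) (U : ℂ) μ (ttFluxCoupling L β t' 0)‖ *
        (Real.exp (2 * a * (L : ℝ) ^ 2 * Real.exp (-(δ * L))) - 1) :=
        mul_le_mul_of_nonneg_left (sub_le_sub_right (Real.exp_le_exp.2 htail) 1) (norm_nonneg _)

end Torus

end Summit.HubbardSuperconductivity.HubbardLadder.Bounds

end
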